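import Summits.RiemannHypothesis.RiemannHypothesis.Theorems.IntegerScrewScrewPolyFloorLandauBlock
import Literature.NumberTheory.LFunctions.LittlewoodPsiOscillationRH
import Literature.NumberTheory.LFunctions.ZetaArgVariation
import HarnessLib

/-!
# Route IntegerScrew — RH-free positivity of the Landau pairing over a window of high zeros

Helper file for crux `IntegerScrew.ScrewPolyFloor` (stmt-RiemannHypothesis-15757), idea card
`Cruxes/ScrewPolyFloor/Ideas/abscissa-blind-head.md` (TailFloor): the window lower bound for the
Landau pairing `D(T) = ∑_{|Im ρ| ≤ T} m(ρ) P_y(ρ−½)P_y(½−ρ)` of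
`IntegerScrewScrewPolyFloorLandauBlock.lean` (`pairing_window_lower_bound`) combined with the
zero count:

* `sum_order_eq_two_mul_zetaZeroCount` — `∑_{|Im ρ| ≤ T} m(ρ) = 2 N(T)` on the index set
  `weilZeroIndex T` (the tree's `LittlewoodRH.sum_zeroOrder_zerosUpTo`, reindexed);
* `zetaZeroCount_window_lower` — Riemann–von Mangoldt (`riemann_von_mangoldt_holds`, `O(log T)`
  form) and the convexity of `T log(T/2π) − T`:
  `N(T₂) − N(T₁) ≥ ((T₂ − T₁)/2π) log(T₁/2π) − C log T₂` for `T* ≤ T₁ ≤ T₂`;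
* `pairing_window_positive` — hence, WITHOUT RH, for `M ≥ 1`, real `y`, `T* ≤ T₁ ≤ T₂`:
  `Re(D(T₂) − D(T₁)) ≥ [((T₂−T₁)/π)(log(T₁/2π) − log M − 1) − C (log T₂ + M⁵ log²T₂)]·∑ y_m²`,
  positive with margin `≍ (T₂ − T₁) log T₁ ∑y²` once `log T₁ ≥ 2(log M + 1) + log 2π` and
  `T₂ − T₁ ≫ M⁵ log T₂` — every such window of zeros acts on length-`M` Dirichlet polynomials as a
  positive form (under RH this is the trivial `∑ m(ρ)|P_y(iγ)|² ≥ 0` plus Landau–Gonek's lower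
  sampling bound; here it is unconditional).
-/

noncomputable section

open Complex Finset Filter Asymptotics
open scoped Real ComplexConjugate Topology

-- the layout-mandated namespace repeats the summit name
set_option linter.dupNamespace false

namespace Summit.RiemannHypothesis.RiemannHypothesis.Theorems.IntegerScrewLandau

open Literature.NumberTheory.LFunctions ArithmeticFunction

/-! ### The zero count on `weilZeroIndex T` -/

/-- **`∑_{|Im ρ| ≤ T} m(ρ) = 2N(T)`** on the index set of the Landau sums (`T ≥ 0`). [folklore] -/
theorem sum_order_eq_two_mul_zetaZeroCount {T : ℝ} (hT : 0 ≤ T) :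
    ∑ ρ ∈ (weilZeroIndex_finite T).toFinset, (riemannZetaZeroOrder ρ : ℝ) = 2 * zetaZeroCount T := by
  classical
  rw [← LittlewoodRH.sum_zeroOrder_zerosUpTo hT]
  symm
  refine Finset.sum_bij (fun (ρ : NicolasJExplicit.Zeros) _ ↦ (ρ : ℂ)) (fun ρ hρ ↦ ?_)
    (fun ρ₁ _ ρ₂ _ h ↦ Subtype.ext h) (fun z hz ↦ ?_) (fun ρ _ ↦ rfl)
  · rw [SchoenfeldBound.mem_zerosUpTo] at hρ
    rw [mem_weilZeroIndex_toFinset]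
    have hmem : (ρ : ℂ) ∈ RHWave0.riemannZetaNontrivialZeros := ρ.2
    exact ⟨ZetaZeros.riemannZetaNontrivialZeros.zeta_eq_zero hmem,
      (ZetaZeros.riemannZetaNontrivialZeros.re_pos hmem).le,
      (ZetaZeros.riemannZetaNontrivialZeros.re_lt_one hmem).le,
      ZetaZeros.riemannZetaNontrivialZeros.im_ne_zero hmem, hρ⟩
  · rw [mem_weilZeroIndex_toFinset] at hz
    obtain ⟨h0, -, -, him, habs⟩ := hz
    have hmem := ZetaZeros.riemannZetaNontrivialZeros.mem_of_im_ne_zero h0 him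
    refine ⟨⟨z, hmem⟩, ?_, rfl⟩
    rw [SchoenfeldBound.mem_zerosUpTo]
    exact habs

/-! ### The zero count in a window, from the Riemann–von Mangoldt formula -/

/-- Convexity of the main term of the Riemann–von Mangoldt formula:
`f(T₂) − f(T₁) ≥ ((T₂ − T₁)/2π) log(T₁/2π)`, `f(T) = (T/2π) log(T/2π) − T/2π` (`0 < T₁ ≤ T₂`;
`log(T₂/T₁) ≥ 1 − T₁/T₂`). [folklore] -/
theorem rvmMain_sub_ge {T₁ T₂ : ℝ} (h1 : 0 < T₁) (h12 : T₁ ≤ T₂) :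
    (T₂ - T₁) / (2 * π) * Real.log (T₁ / (2 * π)) ≤
      (T₂ / (2 * π) * Real.log (T₂ / (2 * π)) - T₂ / (2 * π)) -
        (T₁ / (2 * π) * Real.log (T₁ / (2 * π)) - T₁ / (2 * π)) := by
  have h2 : 0 < T₂ := lt_of_lt_of_le h1 h12
  have hπ : 0 < 2 * π := by positivity
  have hlog : 1 - T₁ / T₂ ≤ Real.log (T₂ / (2 * π)) - Real.log (T₁ / (2 * π)) := by
    have h := Real.one_sub_inv_le_log_of_pos (div_pos h2 h1)
    rw [inv_div] at h
    rw [← Real.log_div (by positivity) (by positivity), div_div_div_cancel_right₀ hπ.ne']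
    exact h
  have key : 0 ≤ T₂ / (2 * π) * (Real.log (T₂ / (2 * π)) - Real.log (T₁ / (2 * π))) -
      (T₂ - T₁) / (2 * π) := by
    have h3 : T₂ / (2 * π) * (1 - T₁ / T₂) = (T₂ - T₁) / (2 * π) := by
      field_simp
    rw [← h3]
    have h4 : 0 ≤ T₂ / (2 * π) := by positivity
    nlinarith [mul_le_mul_of_nonneg_left hlog h4]
  have e : (T₂ / (2 * π) * Real.log (T₂ / (2 * π)) - T₂ / (2 * π)) -
        (T₁ / (2 * π) * Real.log (T₁ / (2 * π)) - T₁ / (2 * π)) -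
      (T₂ - T₁) / (2 * π) * Real.log (T₁ / (2 * π)) =
      T₂ / (2 * π) * (Real.log (T₂ / (2 * π)) - Real.log (T₁ / (2 * π))) - (T₂ - T₁) / (2 * π) := by
    ring
  linarith [key, e]

/-- **Zeros in a window.** From `N(T) = (T/2π)log(T/2π) − T/2π + O(log T)`
(`riemann_von_mangoldt_holds`): there are `C > 0` and `T* ≥ 2` with
`N(T₂) − N(T₁) ≥ ((T₂ − T₁)/2π) log(T₁/2π) − C log T₂` for all `T* ≤ T₁ ≤ T₂`. [folklore] -/
theorem zetaZeroCount_window_lower :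
    ∃ C T₀ : ℝ, 0 < C ∧ 2 ≤ T₀ ∧ ∀ T₁ T₂ : ℝ, T₀ ≤ T₁ → T₁ ≤ T₂ →
      (T₂ - T₁) / (2 * π) * Real.log (T₁ / (2 * π)) - C * Real.log T₂ ≤
        (zetaZeroCount T₂ : ℝ) - zetaZeroCount T₁ := by
  have h : riemann_von_mangoldt := riemann_von_mangoldt_holds
  unfold riemann_von_mangoldt at h
  obtain ⟨c, hc⟩ := h.bound
  rw [Filter.eventually_atTop] at hc
  obtain ⟨T₀, hT₀⟩ := hc
  refine ⟨2 * max c 1, max T₀ 2, by positivity, le_max_right _ _, fun T₁ T₂ h1 h12 ↦ ?_⟩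
  have hT₁2 : 2 ≤ T₁ := (le_max_right _ _).trans h1
  have hT₁0 : 0 < T₁ := by linarith
  have hb1 := hT₀ T₁ ((le_max_left _ _).trans h1)
  have hb2 := hT₀ T₂ ((le_max_left _ _).trans (h1.trans h12))
  have hlog1 : 0 ≤ Real.log T₁ := Real.log_nonneg (by linarith)
  have hlog2 : 0 ≤ Real.log T₂ := Real.log_nonneg (by linarith)
  have hlog12 : Real.log T₁ ≤ Real.log T₂ := Real.log_le_log hT₁0 h12
  rw [Real.norm_eq_abs, Real.norm_eq_abs, abs_of_nonneg hlog1] at hb1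
  rw [Real.norm_eq_abs, Real.norm_eq_abs, abs_of_nonneg hlog2] at hb2
  have hmain := rvmMain_sub_ge hT₁0 h12
  have hc1 : c ≤ max c 1 := le_max_left _ _
  have hm0 : 0 ≤ max c 1 := le_trans zero_le_one (le_max_right _ _)
  have e1 := (abs_le.1 hb1).2
  have e2 := (abs_le.1 hb2).1
  have p1 : c * Real.log T₁ ≤ max c 1 * Real.log T₂ := by
    calc c * Real.log T₁ ≤ max c 1 * Real.log T₁ := mul_le_mul_of_nonneg_right hc1 hlog1
      _ ≤ max c 1 * Real.log T₂ := mul_le_mul_of_nonneg_left hlog12 hm0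
  have p2 : c * Real.log T₂ ≤ max c 1 * Real.log T₂ := mul_le_mul_of_nonneg_right hc1 hlog2
  linarith

/-! ### RH-free positivity of the pairing over a window -/

/-- **RH-free positivity of the Landau pairing over a window of high zeros.** There are absolute
`C > 0` and `T* ≥ 2` such that for all `M ≥ 1`, all real `y`, and all `T* ≤ T₁ ≤ T₂`,
`Re(D(T₂) − D(T₁)) ≥ [((T₂−T₁)/π)(log(T₁/2π) − log M − 1) − C (log T₂ + M⁵ log²T₂)] ∑_{m ≤ M} y_m²`,
`D(T) = ∑_{|Im ρ| ≤ T} m(ρ) P_y(ρ−½)P_y(−(ρ−½))`, `P_y(s) = ∑_{m ≤ M} y_m m^s`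
(`pairing_window_lower_bound` + `zetaZeroCount_window_lower`). [folklore] -/
theorem pairing_window_positive :
    ∃ C T₀ : ℝ, 0 < C ∧ 2 ≤ T₀ ∧ ∀ (M : ℕ), 1 ≤ M → ∀ (y : ℕ → ℝ) (T₁ T₂ : ℝ), T₀ ≤ T₁ → T₁ ≤ T₂ →
      ((T₂ - T₁) / π * (Real.log (T₁ / (2 * π)) - Real.log M - 1) -
          C * (Real.log T₂ + (M : ℝ) ^ 5 * Real.log T₂ ^ 2)) * ∑ m ∈ Icc 1 M, y m ^ 2 ≤
      ((∑ ρ ∈ (weilZeroIndex_finite T₂).toFinset, (riemannZetaZeroOrder ρ : ℂ) *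
          ((∑ m ∈ Icc 1 M, (y m : ℂ) * (m : ℂ) ^ (ρ - 1 / 2)) *
            (∑ m ∈ Icc 1 M, (y m : ℂ) * (m : ℂ) ^ (-(ρ - 1 / 2))))) -
        ∑ ρ ∈ (weilZeroIndex_finite T₁).toFinset, (riemannZetaZeroOrder ρ : ℂ) *
          ((∑ m ∈ Icc 1 M, (y m : ℂ) * (m : ℂ) ^ (ρ - 1 / 2)) *
            (∑ m ∈ Icc 1 M, (y m : ℂ) * (m : ℂ) ^ (-(ρ - 1 / 2))))).re := by
  obtain ⟨CB, hCB0, hB⟩ := pairing_window_lower_bound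
  obtain ⟨CN, T₀, hCN0, hT₀2, hN⟩ := zetaZeroCount_window_lower
  refine ⟨max CB (2 * CN), T₀, lt_max_of_lt_left hCB0, hT₀2, fun M hM y T₁ T₂ h1 h12 ↦ ?_⟩
  have hT₁2 : 2 ≤ T₁ := hT₀2.trans h1
  have hT₁0 : 0 ≤ T₁ := by linarith
  have hT₂0 : 0 ≤ T₂ := by linarith
  have h := hB M hM y T₁ T₂ hT₁2 h12
  have hn := hN T₁ T₂ h1 h12
  rw [sum_order_eq_two_mul_zetaZeroCount hT₂0, sum_order_eq_two_mul_zetaZeroCount hT₁0] at h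
  set S : ℝ := ∑ m ∈ Icc 1 M, y m ^ 2 with hS
  have hS0 : 0 ≤ S := Finset.sum_nonneg fun _ _ ↦ sq_nonneg _
  have hlog2 : 0 ≤ Real.log T₂ := Real.log_nonneg (by linarith)
  have hM5 : 0 ≤ (M : ℝ) ^ 5 * Real.log T₂ ^ 2 := by positivity
  -- the count
  have hcount : (T₂ - T₁) / π * Real.log (T₁ / (2 * π)) - 2 * CN * Real.log T₂ ≤
      2 * zetaZeroCount T₂ - 2 * zetaZeroCount T₁ := by
    have e : (T₂ - T₁) / π * Real.log (T₁ / (2 * π)) = 2 * ((T₂ - T₁) / (2 * π) * Real.log (T₁ / (2 * π))) := by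
      field_simp
    rw [e]
    linarith
  -- constants
  have hc1 : CB ≤ max CB (2 * CN) := le_max_left _ _
  have hc2 : 2 * CN ≤ max CB (2 * CN) := le_max_right _ _
  have h0 : 0 ≤ max CB (2 * CN) := le_trans hCB0.le hc1
  -- assemble
  have step : ((T₂ - T₁) / π * (Real.log (T₁ / (2 * π)) - Real.log M - 1) -
      max CB (2 * CN) * (Real.log T₂ + (M : ℝ) ^ 5 * Real.log T₂ ^ 2)) * S ≤
      (2 * zetaZeroCount T₂ - 2 * zetaZeroCount T₁) * S -
        (T₂ - T₁) / π * (Real.log M + 1) * S - CB * (M : ℝ) ^ 5 * Real.log T₂ ^ 2 * S := by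
    have p1 : ((T₂ - T₁) / π * Real.log (T₁ / (2 * π)) - 2 * CN * Real.log T₂) * S ≤
        (2 * zetaZeroCount T₂ - 2 * zetaZeroCount T₁) * S :=
      mul_le_mul_of_nonneg_right hcount hS0
    have p2 : CB * ((M : ℝ) ^ 5 * Real.log T₂ ^ 2) * S ≤
        max CB (2 * CN) * ((M : ℝ) ^ 5 * Real.log T₂ ^ 2) * S :=
      mul_le_mul_of_nonneg_right (mul_le_mul_of_nonneg_right hc1 hM5) hS0
    have p3 : 2 * CN * Real.log T₂ * S ≤ max CB (2 * CN) * Real.log T₂ * S :=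
      mul_le_mul_of_nonneg_right (mul_le_mul_of_nonneg_right hc2 hlog2) hS0
    nlinarith [p1, p2, p3]
  exact step.trans h

end Summit.RiemannHypothesis.RiemannHypothesis.Theorems.IntegerScrewLandau

end
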